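import Summits.BirchSwinnertonDyer.BirchSwinnertonDyer.Theorems.ResidualThetaTransportAtTwoResidualThetaCountLowerPureAtTwoOfLambdaLower
import Summits.BirchSwinnertonDyer.BirchSwinnertonDyer.Theorems.ResidualThetaTransportAtTwoLambdaLowerBoundOWeierstrass
import Summits.BirchSwinnertonDyer.BirchSwinnertonDyer.Theorems.ResidualThetaTransportAtTwoThetaTransportResidualIso
import Summits.BirchSwinnertonDyer.BirchSwinnertonDyer.Theorems.ResidualThetaTransportAtTwoThetaTransportResidualCount
import Literature.NumberTheory.EllipticCurves.GreenbergSelmerNewform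
import HarnessLib

/-!
# `(R≥)ᵖ` `ResidualThetaCountLowerPureAtTwo` (stmt-BirchSwinnertonDyer-26074) from its four print binders and the ONE research
# statement S2 of line «bt26-lambda» — the skeleton's composition `_of` made sorry-free (lead prover bsd-wall-rtt-p2 g13;
# `--supports stmt-BirchSwinnertonDyer-26074`; closes nothing)

HONEST FRAMING. THEOREMS ONLY — no `def`, no named fact, no `sorry`. Every unproved input is an explicit hypothesis: the route's
print binders PUB-G (`PublishedInputsGreenbergControlAtTwo`, item 24143), GZK (`RankEqAnalyticRankLeOne`, 19921), Serre 1972 Prop. 12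
(`SerreSupersingularDecompositionImageInput`, 27793), PUB-CM (`PublishedInputsCMSideAtTwo`, 27719: Deligne–Carayol integral model +
local universality at `2`), all BY NAME, and the research statement S2 (`hS2`, spelled out in the item's own binders — VERBATIM the
registered stub `stub_cmLambdaLower` of the skeleton of record `Cruxes/ResidualThetaCountLowerPureAtTwo/Lines/bt26_lambda.lean` v5:
the λ-part of the signed main conjecture for the CM partner `g` at `p = 2` with `𝒪_λ`-coefficients, `S₀`-imprimitive, read on the
`ϖ`-torsion of the Θ-transported plus-Selmer set of `A_g = Cofree ρ E` over `ℚ_∞`, in `Set.encard` form). Nothing about any curve is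
asserted unconditionally; the crux is NOT proved; BSD is NOT proved by any of this.

THE POINT (kernel-exact, for the pen / crux-plan seats when S2 is promoted to an item): `26074 ⟸ PUB-G ∧ GZK ∧ Serre ∧ PUB-CM ∧ S2`
over LANDED theorems only — W-side finiteness of `R⁺_{S₀}(W[2]/ℚ_∞)` (`ResidualLayer.residualPlus_finite_of_pub`, g10), the residual
isomorphism `((W[2^∞])[2])^f ≅ A_g[ϖ]` (`Bt26Lambda.stub_residualIso`, p634266: Chebotarev + Brauer–Nesbitt, PROVED), the transport count
`#Sel⁺_{S₀}(ℚ_∞, A_g)[ϖ] = (#R⁺_{S₀}(W[2]/ℚ_∞))^f` (`Bt26Lambda.stub_transport`, p641162, modulo Serre), a uniformiser of the DVR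
`𝒪 = padicCoeffIntegers (range ι)` (`LambdaLowerBoundO.isDiscreteValuationRing_unitBall`), and the arithmetic
`(2^(d+Σ))^f ≤ (#R)^f ⇒ 2^(d+Σ) ≤ #R`. So the research content of the crux on this line is EXACTLY S2 (one statement, ≤ 3900 chars,
registered complete on 26074), and an item carrying S2's text closes 26074 by this theorem the moment it is proved.

References: [BurungaleTian2026] Thm. 2.6, Rem. 2.7; [Kato2004Asterisque] Thm. 12.4–12.5, Conj. 12.10; [Kobayashi2003] Thm. 6.2–6.3,
Thm. 7.3–7.4; [GreenbergVatsal2000] Cor. 2.3, Prop. 2.4; [SerreInventiones1972] Prop. 12; [Carayol1986] Thm. (A).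
-/

set_option autoImplicit false
-- D-0017: single-problem summit, so `Summit.BirchSwinnertonDyer.BirchSwinnertonDyer.…` repeats a namespace BY DESIGN.
set_option linter.dupNamespace false
set_option maxHeartbeats 800000

noncomputable section

open scoped Classical

namespace Summit.BirchSwinnertonDyer.BirchSwinnertonDyer.Theorems.ThetaTransport

/-- **`(R≥)ᵖ` from PUB-G, GZK, Serre, PUB-CM (by name) and S2 (verbatim the registered stub `stub_cmLambdaLower`, v5).**
W-side finiteness (PUB-G ∧ GZK), the PUB-CM datum `(n, ρ, Θ)`, a uniformiser `ϖ` of `𝒪`, the residual isomorphism `j` (p634266),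
the transport count `#Sel_g[ϖ] = (#R_W)^f` with `#(𝒪/ϖ) = 2^f` (p641162, granted Serre), and S2 `2^(f(d+Σ_g)) ≤ #Sel_g[ϖ]`
(`encard` form, made an `ncard` inequality by the finiteness that the count itself supplies); then
`(2^(d+Σ_g))^f ≤ (#R_W)^f ⇒ 2^(d+Σ_g) ≤ #R_W`. [cite: BurungaleTian2026, Thm. 2.6] [cite: Kobayashi2003, Thm. 7.3]
[cite: GreenbergVatsal2000, Cor. 2.3 and Prop. 2.4] -/
theorem residualThetaCountLowerPureAtTwo_of_signedLambdaLowerCM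
    (hPubG : Summit.BirchSwinnertonDyer.BirchSwinnertonDyer.Theses.ResidualThetaTransportAtTwo.PublishedInputsGreenbergControlAtTwo)
    (hGZK : Summit.BirchSwinnertonDyer.BirchSwinnertonDyer.Theses.ResidualThetaTransportAtTwo.RankEqAnalyticRankLeOne)
    (hSe : Summit.BirchSwinnertonDyer.BirchSwinnertonDyer.Theses.ResidualThetaTransportAtTwo.SerreSupersingularDecompositionImageInput)
    (hPubCM : Summit.BirchSwinnertonDyer.BirchSwinnertonDyer.Theses.ResidualThetaTransportAtTwo.PublishedInputsCMSideAtTwo)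
    (hS2 : open Literature.NumberTheory.EllipticCurves GreenbergSelmer GreenbergVatsal2000 Kobayashi2003 ModularForms Rank1Residual Literature.NumberTheory.GaloisRepresentations Literature.NumberTheory.Automorphic IsDedekindDomain NumberField Field Rat.HeightOneSpectrum PowerSeries in ∀ (W : WeierstrassCurve ℚ) [W.IsElliptic] [W.IsGloballyMinimal], ¬ W.HasCM → W.analyticRank = 0 → GoodSS W 2 → W.frobeniusTrace 2 = 0 → W.Δ < 0 → ∀ (M : ℕ) [NeZero M] (g : CuspForm (CongruenceSubgroup.Gamma0 M) 2) (ι : coeffField g →+* PadicAlgCl 2) (Ω : ℂ), Odd M → IsNewform0 g → IsCMForm (liftToGamma1 M 2 g) → cuspCoeff g 2 = 0 → IsCohomologicalPlusPeriod g ι Ω → (∀ ℓ : ℕ, ℓ.Prime → ¬ ℓ ∣ 2 * M * W.conductorNorm ℤ → ‖embCoeff g ι ℓ - (W.frobeniusTrace ℓ : PadicAlgCl 2)‖ < 1) → ∀ (κ : ZpExtension ℚ 2) (γ : absoluteGaloisGroup ℚ), κ.IsCyclotomic → κ.IsTopGenerator γ → IsCyclotomicVariable 2 γ → ∀ (S₀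 : Finset (HeightOneSpectrum (RingOfIntegers ℚ))), (∀ v ∈ S₀, ((2 : ℕ) : RingOfIntegers ℚ) ∉ v.asIdeal) → (∀ v, ¬ W.HasGoodReductionAt v → v ∈ S₀) → (∀ v, natGenerator v ∣ M → v ∈ S₀) → ∀ (Lp Lm : IwasawaAlgebraO (Set.range ι)) (d : ℕ), IsPollackPairK g ι Ω Lp Lm → (∀ k, ‖coeff k (iwasawaOToPowerSeries (Set.range ι) Lm)‖ ≤ ‖coeff d (iwasawaOToPowerSeries (Set.range ι) Lm)‖) → (∀ k < d, ‖coeff k (iwasawaOToPowerSeries (Set.range ι) Lm)‖ < ‖coeff d (iwasawaOToPowerSeries (Set.range ι) Lm)‖) → ∀ (n : ℕ) (ρ : FramedGaloisRep ℚ ↥(padicCoeffIntegers (Set.range ι)) 2) (Θ : ∀ v : HeightOneSpectrum (RingOfIntegers ℚ), ((2 : ℕ) : RingOfIntegers ℚ) ∈ v.asIdeal → (Cofree ρ ↥(padicCoeffField (Set.range ι)) ≃+ (Fin n → ↥(W.geomPrimaryTorsion 2)))), (∀ v, ¬ natGenerator v ∣ 2 * M → ρ.IsUnramifiedAt v ∧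 ∃ P : Polynomial ↥(padicCoeffIntegers (Set.range ι)), P.map (padicCoeffIntegers (Set.range ι)).subtype = Polynomial.X ^ 2 - Polynomial.C (embCoeff g ι (natGenerator v)) * Polynomial.X + Polynomial.C ((natGenerator v : ℕ) : PadicAlgCl 2) ∧ ρ.HasFrobCharpolyAt v P) → (∀ v hv (δ : absoluteGaloisGroup (v.adicCompletion ℚ)) m i, Θ v hv (resGalOfEmb (closureEmb (K := ℚ) (v.adicCompletion ℚ)) δ • m) i = resGalOfEmb (closureEmb (K := ℚ) (v.adicCompletion ℚ)) δ • Θ v hv m i) → ∀ (ϖ : ↥(padicCoeffIntegers (Set.range ι))), Irreducible ϖ → ((Nat.card (↥(padicCoeffIntegers (Set.range ι)) ⧸ Ideal.span {ϖ}) ^ (d + ∑ v ∈ S₀, 2 ^ padicValNat 2 ((natGenerator v ^ 2 - 1) / 8) * (if natGenerator v ∣ M then (if ‖embCoeff g ι (natGenerator v) - 1‖ < 1 then 1 else 0) else (if ‖embCoeff g ι (natGenerator v)‖ < 1 then 2 else 0))) : ℕ) : ℕ∞) ≤ {y : subgroupH1 κ.kerSubgroup (Cofree ρ ↥(padicCoeffField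 (Set.range ι))) | y ∈ unramifiedOutside κ.kerSubgroup (Cofree ρ ↥(padicCoeffField (Set.range ι))) 2 ↑S₀ ∧ (∀ w σ, conjH1 κ.kerSubgroup (Cofree ρ ↥(padicCoeffField (Set.range ι))) σ y ∈ infKer κ.kerSubgroup (Cofree ρ ↥(padicCoeffField (Set.range ι))) w) ∧ (∀ v hv σ, ∃ (φ : _) (Q : Fin n → localPoints W (v.adicCompletion ℚ)) (k : ℕ), oneCocycleClass (discreteTopRep ↥κ.kerSubgroup (Cofree ρ ↥(padicCoeffField (Set.range ι)))) φ = conjH1 κ.kerSubgroup (Cofree ρ ↥(padicCoeffField (Set.range ι))) σ y ∧ (∀ i, (2 ^ k) • Q i ∈ ⨆ m : ℕ, signedLocalPoints κ (v.adicCompletion ℚ) W 1 m) ∧ ∀ τ i, pointsMapOfEmb W (closureEmb (K := ℚ) (v.adicCompletion ℚ)) (((Θ v hv (φ.1 (resGalSubgroupOfEmb κ.kerSubgroup (closureEmb (K := ℚ) (v.adicCompletion ℚ)) τ))) i : ↥(W.geomPrimaryTorsion 2)) : W.geomPoints) = (τ : absoluteGaloisGroup (v.adicCompletion ℚ)) •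 Q i - Q i) ∧ scalarH1 κ.kerSubgroup (Cofree ρ ↥(padicCoeffField (Set.range ι))) ϖ y = 0}.encard) :
    Summit.BirchSwinnertonDyer.BirchSwinnertonDyer.Theses.ResidualThetaTransportAtTwo.ResidualThetaCountLowerPureAtTwo := by

  intro W _ _ hCM hr0 hss ha2 hΔ M _ g ι Ω hM hnew hcmf ha2g hΩ hcong κ γ hκ hγ hcyc S₀ hS₀ hbad hMS D _ htors hμ
    Lp Lm d hpair hle hlt
  -- W-side finiteness of the counted set (PUB-G ∧ GZK, p619334)
  have hfinW := Summit.BirchSwinnertonDyer.BirchSwinnertonDyer.Theorems.ResidualLayer.residualPlus_finite_of_pub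
    hPubG hGZK W hr0 hss ha2 hΔ κ γ hκ hγ S₀ hS₀ hbad D
    htors hμ
  -- the g-side datum (PUB-CM)
  obtain ⟨n, ρ, Θ, hρ, hΘ⟩ := hPubCM W hCM hr0 hss ha2 hΔ M g ι Ω hM hnew hcmf ha2g hΩ hcong
  -- a uniformiser of `𝒪 = padicCoeffIntegers (range ι)` (a DVR: the unit ball of `ℚ₂(ι K_g)`, finite over `ℚ₂`)
  haveI : FiniteDimensional ℚ (Literature.NumberTheory.EllipticCurves.ModularForms.coeffField g) :=
    Literature.NumberTheory.EllipticCurves.ModularForms.IsNewform0.finiteDimensional_coeffField_holds hnew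
  haveI : FiniteDimensional ℚ_[2] ↥(Literature.NumberTheory.EllipticCurves.padicCoeffField (Set.range ι)) :=
    Literature.NumberTheory.EllipticCurves.GreenbergSelmer.finiteDimensional_padicCoeffField ι
  have hdvr : IsDiscreteValuationRing ↥(Literature.NumberTheory.EllipticCurves.padicCoeffIntegers (Set.range ι)) := by
    rw [Literature.NumberTheory.EllipticCurves.padicCoeffIntegers_eq_unitBall]
    exact Summit.BirchSwinnertonDyer.BirchSwinnertonDyer.Theorems.LambdaLowerBoundO.isDiscreteValuationRing_unitBall 2 _
  obtain ⟨ϖ, hϖ⟩ := IsDiscreteValuationRing.exists_irreducible ↥(Literature.NumberTheory.EllipticCurves.padicCoeffIntegers (Set.range ι))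
  -- transport count and CM bound
  obtain ⟨f, hf0, hq, j, hjinj, hjsmul, hjrange⟩ := Summit.BirchSwinnertonDyer.BirchSwinnertonDyer.Cruxes.ResidualThetaCountLowerPureAtTwo.Bt26Lambda.stub_residualIso W hss hΔ M g ι hnew hcong ρ hρ ϖ hϖ
  have hcount := Summit.BirchSwinnertonDyer.BirchSwinnertonDyer.Cruxes.ResidualThetaCountLowerPureAtTwo.Bt26Lambda.stub_transport hSe W hss ha2 hΔ M g ι κ S₀ hMS n ρ Θ
    (fun v hv ↦ (hρ v hv).1) hΘ ϖ hϖ f j hjinj hjsmul hjrange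
  have hposW : 0 < {x : Literature.NumberTheory.EllipticCurves.subgroupH1 κ.kerSubgroup ↥(AddSubgroup.torsionBy ↥(W.geomPrimaryTorsion 2) (2 : ℤ)) | x ∈ Literature.NumberTheory.EllipticCurves.GreenbergVatsal2000.unramifiedOutside κ.kerSubgroup ↥(AddSubgroup.torsionBy ↥(W.geomPrimaryTorsion 2) (2 : ℤ)) 2 (↑S₀ : Set (IsDedekindDomain.HeightOneSpectrum (NumberField.RingOfIntegers ℚ))) ∧ (∀ (w : NumberField.InfinitePlace ℚ) (σ : Field.absoluteGaloisGroup ℚ), Literature.NumberTheory.EllipticCurves.conjH1 κ.kerSubgroup ↥(AddSubgroup.torsionBy ↥(W.geomPrimaryTorsion 2) (2 : ℤ)) σ x ∈ Literature.NumberTheory.EllipticCurves.GreenbergSelmer.infKer κ.kerSubgroup ↥(AddSubgroup.torsionBy ↥(W.geomPrimaryTorsion 2) (2 : ℤ)) w) ∧ (∀ (v : IsDedekindDomain.HeightOneSpectrum (NumberField.RingOfIntegers ℚ)), ((2 : ℕ) : NumberField.RingOfIntegers ℚ) ∈ v.asIdeal → ∀ σ : Field.absoluteGaloisGroup ℚ,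 W.conjH1 2 κ.kerSubgroup σ (Literature.NumberTheory.EllipticCurves.GreenbergVatsal2000.pushH1 κ.kerSubgroup (AddSubgroup.torsionBy ↥(W.geomPrimaryTorsion 2) (2 : ℤ)).subtype (fun _ _ ↦ rfl) x) ∈ Literature.NumberTheory.EllipticCurves.Kobayashi2003.localKummerOverOfEmb W 2 κ.kerSubgroup (Literature.NumberTheory.EllipticCurves.closureEmb (K := ℚ) (v.adicCompletion ℚ)) (⨆ n : ℕ, Literature.NumberTheory.EllipticCurves.Kobayashi2003.signedLocalPoints κ (v.adicCompletion ℚ) W 1 n))}.ncard := (Set.ncard_pos hfinW).2 ⟨0, by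
    refine ⟨AddSubgroup.zero_mem _, fun w σ => ?_, fun v hv σ => ?_⟩
    · rw [map_zero]; exact AddSubgroup.zero_mem _
    · rw [map_zero, map_zero]; exact AddSubgroup.zero_mem _⟩
  have hfinG : {y : Literature.NumberTheory.EllipticCurves.subgroupH1 κ.kerSubgroup (Literature.NumberTheory.EllipticCurves.GreenbergSelmer.Cofree ρ ↥(Literature.NumberTheory.EllipticCurves.padicCoeffField (Set.range ι))) | y ∈ Literature.NumberTheory.EllipticCurves.GreenbergVatsal2000.unramifiedOutside κ.kerSubgroup (Literature.NumberTheory.EllipticCurves.GreenbergSelmer.Cofree ρ ↥(Literature.NumberTheory.EllipticCurves.padicCoeffField (Set.range ι))) 2 (↑S₀ : Set (IsDedekindDomain.HeightOneSpectrum (NumberField.RingOfIntegers ℚ))) ∧ (∀ (w : NumberField.InfinitePlace ℚ) (σ : Field.absoluteGaloisGroup ℚ), Literature.NumberTheory.EllipticCurves.conjH1 κ.kerSubgroup (Literature.NumberTheory.EllipticCurves.GreenbergSelmer.Cofree ρ ↥(Literature.NumberTheory.EllipticCurves.padicCoeffField (Set.range ι))) σ y ∈ Literature.NumberTheory.EllipticCurves.GreenbergSelmer.infKer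 κ.kerSubgroup (Literature.NumberTheory.EllipticCurves.GreenbergSelmer.Cofree ρ ↥(Literature.NumberTheory.EllipticCurves.padicCoeffField (Set.range ι))) w) ∧ (∀ (v : IsDedekindDomain.HeightOneSpectrum (NumberField.RingOfIntegers ℚ)) (hv : ((2 : ℕ) : NumberField.RingOfIntegers ℚ) ∈ v.asIdeal) (σ : Field.absoluteGaloisGroup ℚ), ∃ (φ : ↥(Literature.NumberTheory.GaloisRepresentations.contOneCocycles (Literature.NumberTheory.EllipticCurves.discreteTopRep ↥κ.kerSubgroup (Literature.NumberTheory.EllipticCurves.GreenbergSelmer.Cofree ρ ↥(Literature.NumberTheory.EllipticCurves.padicCoeffField (Set.range ι)))))) (Q : Fin n → Literature.NumberTheory.EllipticCurves.localPoints W (v.adicCompletion ℚ)) (k : ℕ), Literature.NumberTheory.GaloisRepresentations.oneCocycleClass (Literature.NumberTheory.EllipticCurves.discreteTopRep ↥κ.kerSubgroup (Literature.NumberTheory.EllipticCurves.GreenbergSelmer.Cofree ρ ↥(Literature.NumberTheory.EllipticCurves.padicCoeffField (Set.range ι)))) φ = Literature.NumberTheory.EllipticCurves.conjH1 κ.kerSubgroup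 (Literature.NumberTheory.EllipticCurves.GreenbergSelmer.Cofree ρ ↥(Literature.NumberTheory.EllipticCurves.padicCoeffField (Set.range ι))) σ y ∧ (∀ i : Fin n, (2 ^ k) • Q i ∈ ⨆ m : ℕ, Literature.NumberTheory.EllipticCurves.Kobayashi2003.signedLocalPoints κ (v.adicCompletion ℚ) W 1 m) ∧ ∀ (τ : ↥(Literature.NumberTheory.EllipticCurves.localSubgroupOfEmb κ.kerSubgroup (Literature.NumberTheory.EllipticCurves.closureEmb (K := ℚ) (v.adicCompletion ℚ)))) (i : Fin n), Literature.NumberTheory.EllipticCurves.pointsMapOfEmb W (Literature.NumberTheory.EllipticCurves.closureEmb (K := ℚ) (v.adicCompletion ℚ)) (((Θ v hv (φ.1 (Literature.NumberTheory.EllipticCurves.resGalSubgroupOfEmb κ.kerSubgroup (Literature.NumberTheory.EllipticCurves.closureEmb (K := ℚ) (v.adicCompletion ℚ)) τ))) i : ↥(W.geomPrimaryTorsion 2)) : W.geomPoints) = (τ : Field.absoluteGaloisGroup (v.adicCompletion ℚ)) • Q i - Q i) ∧ Literature.NumberTheory.EllipticCurves.GreenbergSelmer.scalarH1 κ.kerSubgroup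 (Literature.NumberTheory.EllipticCurves.GreenbergSelmer.Cofree ρ ↥(Literature.NumberTheory.EllipticCurves.padicCoeffField (Set.range ι))) ϖ y = 0}.Finite := by
    apply Set.finite_of_ncard_pos
    rw [hcount]
    exact pow_pos hposW f
  have hcm := hS2 W hCM hr0 hss ha2 hΔ M g ι Ω hM hnew hcmf ha2g hΩ hcong κ γ hκ hγ hcyc S₀ hS₀ hbad hMS
    Lp Lm d hpair hle (fun k hk ↦ hlt k hk) n ρ Θ hρ hΘ ϖ hϖ
  rw [← hfinG.cast_ncard_eq, Nat.cast_le, hcount, hq, ← pow_mul, mul_comm, pow_mul] at hcm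
  exact (Nat.pow_le_pow_iff_left hf0.ne').1 hcm

end Summit.BirchSwinnertonDyer.BirchSwinnertonDyer.Theorems.ThetaTransport

end
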